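import Summits.Ventures.PackingBounds.Configurations.E8Unique
import Summits.Ventures.PackingBounds.Configurations.Dim6Card27Unique
import Summits.Ventures.PackingBounds.Configurations.Dim7Card56Unique

/-!
# Tight spherical designs: the design form of the uniqueness theorems (`E₈`, `(7,56)`, `(6,27)`)

Framing: lottery ticket; floor = certified bounds/negative ranges. Venture `PackingBounds` (cell
`pub-packcert`, seat `pub-packcert-energy`).

Bannai–Sloane state their uniqueness theorems for TIGHT DESIGNS (Conway–Sloane Ch. 14 Thm 7: a tight spherical
`7`-design in `Ω₈` is the `E₈` root configuration; Thm 11: a tight `5`-design in `Ω₇` is the `(7, 56, 1/3)` code), the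
tree's uniqueness theorems (`E8Unique`, `Dim7Card56Unique`, `Dim6Card27Unique`) for CODES. This file supplies the
bridge, in the tree's moment vocabulary (`Σ_{x,y} C_k^{(μ)}(⟪x,y⟫) = 0`, `1 ≤ k ≤ t`, for a `t`-design):

* `offDiag_eq_zero_of_design` (generic, any `μ`): if `G = Σ_{k ≤ t} g_k C_k^{(μ)}` is nonnegative at the pairs of a
  `t`-design `C` and `|C| g_0 = G(1)` (tightness), then `G(⟪x,y⟫) = 0` for all `x ≠ y ∈ C` — the Fisher-type
  inequality `|C| ≥ G(1)/g_0` with its case of equality, by pure bookkeeping (`Σ_{x,y} G = g_0 |C|²`).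
* `E8.isometric_of_design7`: a `240`-point `7`-design on `S⁷` is an isometric image of `Config.E8.pts`
  (annihilator `(t+1) (t+1/2)² t² (t-1/2)²`, `g_0 = 3/640`);
* `Dim7Card56.isometric_of_design5`: two `56`-point `5`-designs on `S⁶` are isometric (`(t+1)(t+1/3)²(t-1/3)²`, `16/567`);
* `Dim6Card27.isometric_of_design4`: two `27`-point `4`-designs on `S⁵` are isometric (`(t+1/2)²(t-1/4)²`, `3/64`).

## References
* E. Bannai, N. J. A. Sloane, Canad. J. Math. 33 (1981) 437–449 (= Conway–Sloane, *SPLAG*, Ch. 14 Thm 7, 11). [`ConwaySloane1999`]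
* P. Delsarte, J.-M. Goethals, J. J. Seidel, Geom. Dedicata 6 (1977) 363–388 (tight designs).
-/

noncomputable section

namespace Summit.Ventures.PackingBounds.Config.TightDesign

open Finset Literature.Analysis.SpecialFunctions Literature.Geometry.DiscreteGeometry

/-- **Fisher-type equality for designs.** Let `C ⊂ S^{n-1}` satisfy `Σ_{x,y ∈ C} C_k^{(μ)}(⟪x,y⟫) = 0` for
`1 ≤ k ≤ d`, and let `G(s) = Σ_{k ≤ d} g_k C_k^{(μ)}(s)` be nonnegative at the inner products of distinct points of
`C`. If `|C| · g_0 = G(1)` then `G(⟪x,y⟫) = 0` for all distinct `x, y ∈ C`. -/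
theorem offDiag_eq_zero_of_design {n : ℕ} (μ : ℝ) (C : Finset (EuclideanSpace ℝ (Fin n)))
    (h1 : ∀ x ∈ C, ‖x‖ = 1) (d : ℕ) (g : ℕ → ℝ) (G : ℝ → ℝ)
    (hG : ∀ s, G s = ∑ k ∈ range (d + 1), g k * gegenbauerSum μ k s)
    (hdes : ∀ k, 1 ≤ k → k ≤ d → ∑ x ∈ C, ∑ y ∈ C, gegenbauerSum μ k (inner ℝ x y) = 0)
    (hpos : ∀ x ∈ C, ∀ y ∈ C, x ≠ y → 0 ≤ G (inner ℝ x y)) (htight : (C.card : ℝ) * g 0 = G 1) :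
    ∀ x ∈ C, ∀ y ∈ C, x ≠ y → G (inner ℝ x y) = 0 := by
  classical
  -- total: `Σ_{x,y} G = g_0 |C|²`
  have htot : ∑ x ∈ C, ∑ y ∈ C, G (inner ℝ x y) = g 0 * (C.card : ℝ) ^ 2 := by
    have hx : ∀ x ∈ C, ∑ y ∈ C, G (inner ℝ x y) =
        ∑ k ∈ range (d + 1), g k * ∑ y ∈ C, gegenbauerSum μ k (inner ℝ x y) := by
      intro x _
      rw [Finset.sum_congr rfl fun y _ => hG (inner ℝ x y), Finset.sum_comm]
      exact Finset.sum_congr rfl fun k _ => by rw [Finset.mul_sum]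
    have hswap : ∑ x ∈ C, ∑ y ∈ C, G (inner ℝ x y) =
        ∑ k ∈ range (d + 1), g k * ∑ x ∈ C, ∑ y ∈ C, gegenbauerSum μ k (inner ℝ x y) := by
      rw [Finset.sum_congr rfl hx, Finset.sum_comm]
      exact Finset.sum_congr rfl fun k _ => by rw [Finset.mul_sum]
    rw [hswap, ← Finset.add_sum_erase _ _ (Finset.mem_range.2 (Nat.succ_pos d))]
    have hrest : ∑ k ∈ (range (d + 1)).erase 0, g k * ∑ x ∈ C, ∑ y ∈ C, gegenbauerSum μ k (inner ℝ x y) = 0 := by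
      refine Finset.sum_eq_zero fun k hk => ?_
      obtain ⟨hk0, hkd⟩ := Finset.mem_erase.mp hk
      rw [hdes k (Nat.pos_of_ne_zero hk0) (by have := Finset.mem_range.mp hkd; omega), mul_zero]
    rw [hrest, add_zero]
    simp only [gegenbauerSum_zero, sum_const]
    ring
  -- diagonal split
  have hdiag : ∑ x ∈ C, ∑ y ∈ C, G (inner ℝ x y) = (C.card : ℝ) * G 1 + ∑ x ∈ C, ∑ y ∈ C.erase x, G (inner ℝ x y) := by
    have hx : ∀ x ∈ C, ∑ y ∈ C, G (inner ℝ x y) = G 1 + ∑ y ∈ C.erase x, G (inner ℝ x y) := by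
      intro x hx
      rw [← Finset.add_sum_erase C _ hx, real_inner_self_eq_norm_sq, h1 x hx, one_pow]
    rw [Finset.sum_congr rfl hx, Finset.sum_add_distrib, sum_const, nsmul_eq_mul]
  have hoff : ∑ x ∈ C, ∑ y ∈ C.erase x, G (inner ℝ x y) = 0 := by
    have : ∑ x ∈ C, ∑ y ∈ C.erase x, G (inner ℝ x y) = (C.card : ℝ) * ((C.card : ℝ) * g 0 - G 1) := by
      linarith [htot, hdiag]
    rw [this, htight, sub_self, mul_zero]
  have hnn : ∀ x ∈ C, ∀ y ∈ C.erase x, 0 ≤ G (inner ℝ x y) := fun x hx y hy =>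
    hpos x hx y (Finset.mem_of_mem_erase hy) (Finset.ne_of_mem_erase hy).symm
  intro x hx y hy hxy
  have hx0 := (Finset.sum_eq_zero_iff_of_nonneg fun x hx => Finset.sum_nonneg fun y hy => hnn x hx y hy).mp hoff x hx
  exact (Finset.sum_eq_zero_iff_of_nonneg fun y hy => hnn x hx y hy).mp hx0 y (Finset.mem_erase.mpr ⟨hxy.symm, hy⟩)

end TightDesign

/-! ### `E₈`: tight `7`-designs in `S⁷` (Conway–Sloane Ch. 14 Thm 7) -/

namespace E8TightDesign

open Finset Literature.Analysis.SpecialFunctions Literature.Geometry.DiscreteGeometry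

/-- The annihilator `(t+1)(t+1/2)² t² (t-1/2)²` in the Gegenbauer basis of `S⁷`. -/
private theorem hpoly (s : ℝ) : (s + 1) * ((s + 1 / 2) ^ 2 * (s ^ 2 * (s - 1 / 2) ^ 2)) =
    ∑ k ∈ range (7 + 1), (fun k => match k with
      | 0 => 3 / 640 | 1 => 1 / 320 | 2 => 3 / 896 | 3 => 39 / 17920 | 4 => 7 / 3840 | 5 => 1 / 1008
      | 6 => 1 / 1792 | 7 => 1 / 4608 | _ => 0) k * gegenbauerSum (3 : ℝ) k s := by
  simp [Finset.sum_range_succ, gegenbauerSum, gegenbauerCoeff, Finset.prod_range_succ, Nat.factorial]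
  ring

/-- **A `240`-point `7`-design on `S⁷` is a kissing configuration** (inner products of distinct points in
`{-1, ±1/2, 0}`, hence `≤ 1/2`). [cite: ConwaySloane1999, Ch. 14 Thm. 7] -/
theorem inner_le_half_of_design7 {C : Finset (EuclideanSpace ℝ (Fin 8))} (h1 : ∀ x ∈ C, ‖x‖ = 1)
    (hN : C.card = 240) (hdes : ∀ k, 1 ≤ k → k ≤ 7 → ∑ x ∈ C, ∑ y ∈ C, gegenbauerSum (3 : ℝ) k (inner ℝ x y) = 0) :
    ∀ x ∈ C, ∀ y ∈ C, x ≠ y → inner ℝ x y ≤ 1 / 2 := by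
  have h0 := TightDesign.offDiag_eq_zero_of_design 3 C h1 7
    (fun k => match k with
      | 0 => 3 / 640 | 1 => 1 / 320 | 2 => 3 / 896 | 3 => 39 / 17920 | 4 => 7 / 3840 | 5 => 1 / 1008
      | 6 => 1 / 1792 | 7 => 1 / 4608 | _ => 0)
    (fun s => (s + 1) * ((s + 1 / 2) ^ 2 * (s ^ 2 * (s - 1 / 2) ^ 2))) hpoly hdes
    (fun x hx y hy _ => by
      have hb := abs_real_inner_le_norm x y
      rw [h1 x hx, h1 y hy, one_mul] at hb
      exact mul_nonneg (by linarith [(abs_le.mp hb).1]) (by positivity))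
    (by rw [hN]; norm_num)
  intro x hx y hy hxy
  have h := h0 x hx y hy hxy
  have hb := abs_real_inner_le_norm x y
  rw [h1 x hx, h1 y hy, one_mul] at hb
  rcases mul_eq_zero.mp h with h | h
  · linarith
  rcases mul_eq_zero.mp h with h | h
  · have := pow_eq_zero_iff two_ne_zero |>.mp h; linarith
  rcases mul_eq_zero.mp h with h | h
  · have := pow_eq_zero_iff two_ne_zero |>.mp h; linarith
  · have := pow_eq_zero_iff two_ne_zero |>.mp h; linarith

/-- **Conway–Sloane Ch. 14 Theorem 7**: a tight spherical `7`-design in `S⁷` (`240` points, Gegenbauer moments of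
orders `1…7` vanishing) is an isometric image of the `E₈` root configuration `Config.E8.pts`.
[cite: ConwaySloane1999, Ch. 14 Thm. 7] -/
theorem isometric_E8_of_design7 {C : Finset (EuclideanSpace ℝ (Fin 8))} (h1 : ∀ x ∈ C, ‖x‖ = 1)
    (hN : C.card = 240) (hdes : ∀ k, 1 ≤ k → k ≤ 7 → ∑ x ∈ C, ∑ y ∈ C, gegenbauerSum (3 : ℝ) k (inner ℝ x y) = 0) :
    ∃ Ψ : EuclideanSpace ℝ (Fin 8) ≃ₗᵢ[ℝ] EuclideanSpace ℝ (Fin 8), C = E8.pts.image Ψ :=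
  E8Unique.isometric_E8Roots C h1 (inner_le_half_of_design7 h1 hN hdes) hN

end E8TightDesign

/-! ### `(7, 56)`: tight `5`-designs in `S⁶` (Conway–Sloane Ch. 14 Thm 11) -/

namespace Dim7Card56TightDesign

open Finset Literature.Analysis.SpecialFunctions Literature.Geometry.DiscreteGeometry

/-- The annihilator `(t+1)(t+1/3)²(t-1/3)²` in the Gegenbauer basis of `S⁶`. -/
private theorem hpoly (s : ℝ) : (s + 1) * ((s + 1 / 3) ^ 2 * (s - 1 / 3) ^ 2) =
    ∑ k ∈ range (5 + 1), (fun k => match k with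
      | 0 => 16 / 567 | 1 => 16 / 891 | 2 => 64 / 3465 | 3 => 128 / 12285 | 4 => 8 / 1155 | 5 => 8 / 3003
      | _ => 0) k * gegenbauerSum ((5 / 2 : ℝ)) k s := by
  simp [Finset.sum_range_succ, gegenbauerSum, gegenbauerCoeff, Finset.prod_range_succ, Nat.factorial]
  ring

/-- **A `56`-point `5`-design on `S⁶` is a `(7, 56, 1/3)` code.** [cite: ConwaySloane1999, Ch. 14 Thm. 11] -/
theorem inner_le_third_of_design5 {C : Finset (EuclideanSpace ℝ (Fin 7))} (h1 : ∀ x ∈ C, ‖x‖ = 1)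
    (hN : C.card = 56)
    (hdes : ∀ k, 1 ≤ k → k ≤ 5 → ∑ x ∈ C, ∑ y ∈ C, gegenbauerSum ((5 / 2 : ℝ)) k (inner ℝ x y) = 0) :
    ∀ x ∈ C, ∀ y ∈ C, x ≠ y → inner ℝ x y ≤ 1 / 3 := by
  have h0 := TightDesign.offDiag_eq_zero_of_design (5 / 2) C h1 5
    (fun k => match k with
      | 0 => 16 / 567 | 1 => 16 / 891 | 2 => 64 / 3465 | 3 => 128 / 12285 | 4 => 8 / 1155 | 5 => 8 / 3003
      | _ => 0)
    (fun s => (s + 1) * ((s + 1 / 3) ^ 2 * (s - 1 / 3) ^ 2)) hpoly hdes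
    (fun x hx y hy _ => by
      have hb := abs_real_inner_le_norm x y
      rw [h1 x hx, h1 y hy, one_mul] at hb
      exact mul_nonneg (by linarith [(abs_le.mp hb).1]) (by positivity))
    (by rw [hN]; norm_num)
  intro x hx y hy hxy
  have h := h0 x hx y hy hxy
  have hb := abs_real_inner_le_norm x y
  rw [h1 x hx, h1 y hy, one_mul] at hb
  rcases mul_eq_zero.mp h with h | h
  · linarith
  rcases mul_eq_zero.mp h with h | h
  · have := pow_eq_zero_iff two_ne_zero |>.mp h; linarith
  · have := pow_eq_zero_iff two_ne_zero |>.mp h; linarith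

/-- **Conway–Sloane Ch. 14 Theorem 11**: any two tight spherical `5`-designs in `S⁶` (`56` points, moments `1…5`
vanishing) are isometric — each is the `(7, 56, 1/3)` code. [cite: ConwaySloane1999, Ch. 14 Thm. 11] -/
theorem isometric_of_design5 {C C' : Finset (EuclideanSpace ℝ (Fin 7))} (h1 : ∀ x ∈ C, ‖x‖ = 1) (hN : C.card = 56)
    (hdes : ∀ k, 1 ≤ k → k ≤ 5 → ∑ x ∈ C, ∑ y ∈ C, gegenbauerSum ((5 / 2 : ℝ)) k (inner ℝ x y) = 0)
    (h1' : ∀ x ∈ C', ‖x‖ = 1) (hN' : C'.card = 56)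
    (hdes' : ∀ k, 1 ≤ k → k ≤ 5 → ∑ x ∈ C', ∑ y ∈ C', gegenbauerSum ((5 / 2 : ℝ)) k (inner ℝ x y) = 0) :
    ∃ Ψ : EuclideanSpace ℝ (Fin 7) ≃ₗᵢ[ℝ] EuclideanSpace ℝ (Fin 7), C' = C.image Ψ :=
  Dim7Card56Unique.isometric h1 (inner_le_third_of_design5 h1 hN hdes) hN h1'
    (inner_le_third_of_design5 h1' hN' hdes') hN'

end Dim7Card56TightDesign

/-! ### `(6, 27)`: tight `4`-designs in `S⁵` -/

namespace Dim6Card27TightDesign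

open Finset Literature.Analysis.SpecialFunctions Literature.Geometry.DiscreteGeometry

/-- The annihilator `(t+1/2)²(t-1/4)²` in the Gegenbauer basis of `S⁵`. -/
private theorem hpoly (s : ℝ) : (s + 1 / 2) ^ 2 * (s - 1 / 4) ^ 2 =
    ∑ k ∈ range (4 + 1), (fun k => match k with
      | 0 => 3 / 64 | 1 => 1 / 32 | 2 => 11 / 320 | 3 => 1 / 64 | 4 => 1 / 80 | _ => 0) k *
      gegenbauerSum (2 : ℝ) k s := by
  simp [Finset.sum_range_succ, gegenbauerSum, gegenbauerCoeff, Finset.prod_range_succ, Nat.factorial]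
  ring

/-- **A `27`-point `4`-design on `S⁵` is a `(6, 27, 1/4)` code.** [cite: CohnKumar2006, Table 1] -/
theorem inner_le_quarter_of_design4 {C : Finset (EuclideanSpace ℝ (Fin 6))} (h1 : ∀ x ∈ C, ‖x‖ = 1)
    (hN : C.card = 27)
    (hdes : ∀ k, 1 ≤ k → k ≤ 4 → ∑ x ∈ C, ∑ y ∈ C, gegenbauerSum (2 : ℝ) k (inner ℝ x y) = 0) :
    ∀ x ∈ C, ∀ y ∈ C, x ≠ y → inner ℝ x y ≤ 1 / 4 := by
  have h0 := TightDesign.offDiag_eq_zero_of_design 2 C h1 4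
    (fun k => match k with
      | 0 => 3 / 64 | 1 => 1 / 32 | 2 => 11 / 320 | 3 => 1 / 64 | 4 => 1 / 80 | _ => 0)
    (fun s => (s + 1 / 2) ^ 2 * (s - 1 / 4) ^ 2) hpoly hdes (fun x _ y _ _ => by positivity)
    (by rw [hN]; norm_num)
  intro x hx y hy hxy
  have h := h0 x hx y hy hxy
  rcases mul_eq_zero.mp h with h | h
  · have := pow_eq_zero_iff two_ne_zero |>.mp h; linarith
  · have := pow_eq_zero_iff two_ne_zero |>.mp h; linarith

/-- **Tight `4`-designs in `S⁵` are unique**: any two `27`-point `4`-designs on `S⁵` are isometric — each is the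
`(6, 27, 1/4)` (Schläfli) code. [cite: CohnKumar2006, Appendix A] -/
theorem isometric_of_design4 {C C' : Finset (EuclideanSpace ℝ (Fin 6))} (h1 : ∀ x ∈ C, ‖x‖ = 1) (hN : C.card = 27)
    (hdes : ∀ k, 1 ≤ k → k ≤ 4 → ∑ x ∈ C, ∑ y ∈ C, gegenbauerSum (2 : ℝ) k (inner ℝ x y) = 0)
    (h1' : ∀ x ∈ C', ‖x‖ = 1) (hN' : C'.card = 27)
    (hdes' : ∀ k, 1 ≤ k → k ≤ 4 → ∑ x ∈ C', ∑ y ∈ C', gegenbauerSum (2 : ℝ) k (inner ℝ x y) = 0) :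
    ∃ Ψ : EuclideanSpace ℝ (Fin 6) ≃ₗᵢ[ℝ] EuclideanSpace ℝ (Fin 6), C' = C.image Ψ :=
  Dim6Card27Unique.isometric h1 (inner_le_quarter_of_design4 h1 hN hdes) hN h1'
    (inner_le_quarter_of_design4 h1' hN' hdes') hN'

end Dim6Card27TightDesign

end Summit.Ventures.PackingBounds.Config

end
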